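import Literature.Computability.QuantumComplexity.PauliPathNoisyXEB
import Literature.Computability.QuantumComplexity.PauliPathLegal
import Literature.Barriers.QuantumAdvantage.LinearXEBSpoofing
import HarnessLib

/-!
# The noisy linear-XEB score of a Pauli-framed circuit is its Fourier weight enumerator

Topic `Literature/Computability/QuantumComplexity`, sub-namespace `PauliPath`; sequel of
`PauliPathNoisyXEB` (the two-rate frame orthogonality identity) and `PauliPathLegal` (Lemma 4's
`W_0 = 1`, `W_k = 0` for `0 < k ≤ d`), in the finite Pauli-frame model of
`PauliPathOrthogonality` (AGLLV23 Definition 3 with the uniform Pauli-frame ensemble of a FIXED layer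
sequence; general gate-random ensembles are mixtures of such families and are not treated here).

HONEST FRAMING. Everything below is an exact identity or an elementary inequality about the HONEST
`γ`-noisy device scored against its own ideal distribution, and about the truncation certificate of
AGLLV23 §3; nothing here is a statement about any other simulator, and nothing here proves or refutes a
quantum advantage.

## What is recorded (real-valued book-keeping, `λ = 1 − γ`, `n = |ι|`, `F = (4ⁿ)^{d+1}` frames)

* Vocabulary: `idealOut` / `noisyOut` (the real numbers `p_W(x)`, `p̃_W(x)` — real parts of the tree's
  `noisyValue`, which IS real here: `conj_noisyValue_frame_proj`), `frameXEB` (the tree's `linearXEB` of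
  the noisy device against the ideal framed circuit), `frameCount`, `avgXEB` (`E_W XEB_γ`), `wt`
  (`W_k ∈ ℝ`), `weightEnumerator` (`Φ_C(t) := Σ_{k=0}^{n(d+1)} t^k W_k`), `AGLLVCertifies` (the
  right-hand side of the tree's Markov certificate `card_frame_l1TruncError_ge_mul_sq_le` is at most
  `δ · F · ε²`).
* **`avgXEB_add_one_eq_weightEnumerator`** — `E_W[XEB_γ] + 1 = Φ_C(1 − γ)`: "the XEB of noisy random
  circuits can be viewed as the Fourier weight polynomial `Σ_{k>0} (1−γ)^k W_k`"
  [cite: AharonovEtAl2023, §5 (display before Theorem 4), arXiv p. 16] — any layer matrices, any basis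
  input, any reference output `x₀`, any real `γ`.
* **`noisyXEBSandwich`** — for unitary layers and `0 ≤ γ ≤ 1`:
  `(1−γ)^{n(d+1)} · α′ ≤ E_W XEB_γ ≤ (1−γ)^{d+1} · α′` with `α′ := E_W XEB_0` (the printed step
  `XEB = Σ_{k ≥ d+1} (1−γ)^k W_k ≤ (1−γ)^{d+1} · Σ_k W_k` of the proof of Theorem 4, with the
  anti-concentration `O(1)` kept EXACT as `α′`; the floor is `|s| ≤ n(d+1)`)
  [cite: AharonovEtAl2023, Theorem 4 (proof, first display) and Lemma 4 (items 1–2)].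
* **`two_pow_mul_sum_frame_sum_norm_sq_eq`** — the anti-concentration factor of the certificate is
  `F · (α′ + 1)` exactly (Lemma 4's chain, real form) [cite: AharonovEtAl2023, Lemma 4 (proof)];
  **`agllvCertifies_iff`** — the certificate reads `(1−γ)^{2(ℓ+1)} (α′ + 1) ≤ δ ε²`.
* **`certificateLevelDichotomy`** — passing XEB at level `χ > 0` AND certifying `(ε, δ)` at level `ℓ`
  force `(α′+1)^{d+1} χ^{2(ℓ+1)} ≤ (δε²)^{d+1} α′^{2(ℓ+1)}` (elementary combination of the two
  previous items, recorded for the cell line `xeb-pauli-path-dichotomy`).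
* **`agllvSufficientLevel`** — the certificate HOLDS once `2γ(ℓ+1) ≥ ln((1+α′)/(δε²))`: the printed
  "`ℓ ≥ (1/γ) log(O(1)/(ε√δ))`" [cite: AharonovEtAl2023, §3.3 (display after eq. (tvdboundwhp)),
  arXiv p. 13] with the `O(1)` made exact.

## References

* [AharonovEtAl2023] D. Aharonov, X. Gao, Z. Landau, Y. Liu, U. Vazirani, *A polynomial-time classical
  algorithm for noisy random circuit sampling*, STOC 2023, 945–957, arXiv:2211.03999 — §2 (Definitions
  1–5, Lemma 4), §3.3, §5 (the XEB display and Theorem 4).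
* [BarakChouGao2021] B. Barak, C.-N. Chou, X. Gao, *Spoofing linear cross-entropy benchmarking in
  shallow quantum circuits*, ITCS 2021, arXiv:2005.02421 — the linear XEB functional (`linearXEB`).
-/

noncomputable section

open Matrix Finset
open Literature.Barriers.QuantumAdvantage (linearXEB)

namespace Literature.Computability.QuantumComplexity

namespace PauliPath

variable {ι : Type*} [Fintype ι] [DecidableEq ι]

/-! ### Realness of the framed values (basis input, basis read-out, real rate) -/

omit [Fintype ι] [DecidableEq ι] in
/-- The conjugation signs are real. [cite: AharonovEtAl2023, §2 (proof of Lemma 2: V P V† = ±P)] -/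
private theorem conj_sign' (Q P : Pauli) : (starRingEnd ℂ) (Pauli.sign Q P) = Pauli.sign Q P := by
  unfold Pauli.sign
  split_ifs <;> simp

omit [DecidableEq ι] in
/-- The sign characters are real. [cite: AharonovEtAl2023, §2 (proof of Lemma 2)] -/
private theorem conj_strSign' (W S : ι → Pauli) : (starRingEnd ℂ) (strSign W S) = strSign W S := by
  rw [strSign_eq, map_prod]
  exact Finset.prod_congr rfl fun i _ => conj_sign' _ _

omit [Fintype ι] [DecidableEq ι] in
/-- The square of a real complex number is the cast of its squared modulus. [cite: AharonovEtAl2023, §2 (f(C,s,x) ∈ ℝ)] -/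
private theorem sq_eq_ofReal_norm_sq' {z : ℂ} (hz : (starRingEnd ℂ) z = z) :
    z ^ 2 = ((‖z‖ ^ 2 : ℝ) : ℂ) := by
  obtain ⟨t, rfl⟩ : ∃ t : ℝ, (t : ℂ) = z := ⟨z.re, Complex.conj_eq_iff_re.mp hz⟩
  rw [Complex.norm_real, Real.norm_eq_abs, sq_abs]
  push_cast
  ring

/-- **`p̃_W(x) ∈ ℝ`**: the framed value on a basis input `|y⟩⟨y|` with basis read-out `|x⟩⟨x|` is real
at every real noise rate, whatever the layer matrices (`f̃(C_W,s,x) ∈ ℝ` path by path).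
[cite: AharonovEtAl2023, Definition 1 and §2 (display after Definition 2: f(C,s,x) ∈ ℝ)] -/
theorem conj_noisyValue_frame_proj (r : ℝ) {d : ℕ} (U : Fin d → Matrix (ι → Bool) (ι → Bool) ℂ)
    (y : ι → Bool) (W : Fin (d + 1) → ι → Pauli) (x : ι → Bool) :
    (starRingEnd ℂ) (noisyValue (r : ℂ) (frameLayers U W) (proj y) (frameObs (proj x) W)) =
      noisyValue (r : ℂ) (frameLayers U W) (proj y) (frameObs (proj x) W) := by
  rw [noisyValue_eq_sum_pathCoeff, map_sum]
  refine Finset.sum_congr rfl fun s _ => ?_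
  rw [pathCoeff_frame, map_mul, map_prod,
    conj_pathCoeff_ofReal r U (conjTranspose_proj y) (conjTranspose_proj x)]
  congr 1
  exact Finset.prod_congr rfl fun t _ => conj_strSign' _ _

/-- **`W_k ∈ ℝ`** for a basis input (every `f(C,s,x₀)` is real).
[cite: AharonovEtAl2023, Definition 5 and §2 (f(C,s,x) ∈ ℝ)] -/
theorem conj_fourierWeight_zero_proj {d : ℕ} (U : Fin d → Matrix (ι → Bool) (ι → Bool) ℂ)
    (y x₀ : ι → Bool) (k : ℕ) :
    (starRingEnd ℂ) (fourierWeight 0 U (proj y) x₀ k) = fourierWeight 0 U (proj y) x₀ k := by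
  simp only [fourierWeight, map_mul, map_pow, map_sum, map_ofNat,
    conj_pathCoeff_zero U (conjTranspose_proj y) (conjTranspose_proj x₀)]

/-! ### Real-valued vocabulary -/

/-- Ideal output value `p_W(x) = ⟨x| C_W |y⟩…` of the framed circuit on the basis input `|y⟩⟨y|`
(the real part of the tree's `noisyValue 0`; it is real, `ofReal_idealOut`).
[cite: AharonovEtAl2023, Definition 1 (p(C,x))] -/
def idealOut {d : ℕ} (U : Fin d → Matrix (ι → Bool) (ι → Bool) ℂ) (y : ι → Bool)
    (W : Fin (d + 1) → ι → Pauli) (x : ι → Bool) : ℝ :=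
  (noisyValue 0 (frameLayers U W) (proj y) (frameObs (proj x) W)).re

/-- Honest `γ`-noisy output value `p̃_W(x)` of the framed circuit on the basis input `|y⟩⟨y|`
(the real part of the tree's `noisyValue γ`; it is real, `ofReal_noisyOut`).
[cite: AharonovEtAl2023, Definition 1 (p̃(C,x))] -/
def noisyOut (γ : ℝ) {d : ℕ} (U : Fin d → Matrix (ι → Bool) (ι → Bool) ℂ) (y : ι → Bool)
    (W : Fin (d + 1) → ι → Pauli) (x : ι → Bool) : ℝ :=
  (noisyValue (γ : ℂ) (frameLayers U W) (proj y) (frameObs (proj x) W)).re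

/-- Linear XEB score of the honest `γ`-noisy device against its own ideal distribution, in frame `W`:
`2ⁿ Σ_x p_W(x) p̃_W(x) − 1` (the tree's `linearXEB`).
[cite: AharonovEtAl2023, §5 (display defining the linear cross entropy, arXiv p. 16)] -/
def frameXEB (γ : ℝ) {d : ℕ} (U : Fin d → Matrix (ι → Bool) (ι → Bool) ℂ) (y : ι → Bool)
    (W : Fin (d + 1) → ι → Pauli) : ℝ :=
  linearXEB (idealOut U y W) (noisyOut γ U y W)

/-- Frame count `F = (4ⁿ)^{d+1}` of the uniform Pauli-frame ensemble.
[cite: AharonovEtAl2023, Definition 3 (random Pauli frames)] -/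
def frameCount (ι : Type*) [Fintype ι] (d : ℕ) : ℝ := ((4 : ℝ) ^ Fintype.card ι) ^ (d + 1)

/-- Frame-averaged honest noisy XEB score `E_W XEB_γ`; at `γ = 0` it is the ideal mean score `α′`
(anti-concentration constant minus one). [cite: AharonovEtAl2023, §5 (display before Theorem 4)] -/
def avgXEB (γ : ℝ) {d : ℕ} (U : Fin d → Matrix (ι → Bool) (ι → Bool) ℂ) (y : ι → Bool) : ℝ :=
  (∑ W : Fin (d + 1) → ι → Pauli, frameXEB γ U y W) / frameCount ι d

/-- The noiseless Fourier weight `W_k` as a real number. [cite: AharonovEtAl2023, Definition 5] -/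
def wt {d : ℕ} (U : Fin d → Matrix (ι → Bool) (ι → Bool) ℂ) (y x₀ : ι → Bool) (k : ℕ) : ℝ :=
  (fourierWeight 0 U (proj y) x₀ k).re

/-- The WEIGHT ENUMERATOR `Φ_C(t) = Σ_{k=0}^{n(d+1)} t^k W_k` ("the Fourier weight polynomial").
[cite: AharonovEtAl2023, §5 (display before Theorem 4: Σ_k (1−γ)^k W_k)] -/
def weightEnumerator (t : ℝ) {d : ℕ} (U : Fin d → Matrix (ι → Bool) (ι → Bool) ℂ)
    (y x₀ : ι → Bool) : ℝ :=
  ∑ k ∈ Finset.range (Fintype.card ι * (d + 1) + 1), t ^ k * wt U y x₀ k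

/-- AGLLV's §3 certificate at truncation level `ℓ` for accuracy `ε` and failure fraction `δ`, in the
frame model: the right-hand side of the tree's Markov bound `card_frame_l1TruncError_ge_mul_sq_le` is
at most `δ · F · ε²` (so at most a `δ`-fraction of the frames has `‖p̃_W − q̄_{ℓ,W}‖₁ ≥ ε`).
[cite: AharonovEtAl2023, §3.3 (Markov step: "with probability at least 1−δ over C … Δ ≤ ε")] -/
def AGLLVCertifies (γ ε δ : ℝ) (ℓ : ℕ) {d : ℕ} (U : Fin d → Matrix (ι → Bool) (ι → Bool) ℂ)
    (y : ι → Bool) : Prop :=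
  (2 : ℝ) ^ Fintype.card ι * (((1 - γ) ^ 2) ^ (ℓ + 1) *
      ∑ W : Fin (d + 1) → ι → Pauli, ∑ x : ι → Bool,
        ‖noisyValue 0 (frameLayers U W) (proj y) (frameObs (proj x) W)‖ ^ 2) ≤
    δ * frameCount ι d * ε ^ 2

/-! ### Casts back to the tree's complex quantities -/

/-- `p_W(x)` is the tree's `noisyValue 0`. [cite: AharonovEtAl2023, Definition 1] -/
theorem ofReal_idealOut {d : ℕ} (U : Fin d → Matrix (ι → Bool) (ι → Bool) ℂ) (y : ι → Bool)
    (W : Fin (d + 1) → ι → Pauli) (x : ι → Bool) :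
    ((idealOut U y W x : ℝ) : ℂ) = noisyValue 0 (frameLayers U W) (proj y) (frameObs (proj x) W) := by
  have h := conj_noisyValue_frame_proj 0 U y W x
  rw [Complex.ofReal_zero] at h
  exact Complex.conj_eq_iff_re.mp h

/-- `p̃_W(x)` is the tree's `noisyValue γ`. [cite: AharonovEtAl2023, Definition 1] -/
theorem ofReal_noisyOut (γ : ℝ) {d : ℕ} (U : Fin d → Matrix (ι → Bool) (ι → Bool) ℂ) (y : ι → Bool)
    (W : Fin (d + 1) → ι → Pauli) (x : ι → Bool) :
    ((noisyOut γ U y W x : ℝ) : ℂ) =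
      noisyValue (γ : ℂ) (frameLayers U W) (proj y) (frameObs (proj x) W) :=
  Complex.conj_eq_iff_re.mp (conj_noisyValue_frame_proj γ U y W x)

/-- `W_k` (real) is the tree's `fourierWeight 0`. [cite: AharonovEtAl2023, Definition 5] -/
theorem ofReal_wt {d : ℕ} (U : Fin d → Matrix (ι → Bool) (ι → Bool) ℂ) (y x₀ : ι → Bool) (k : ℕ) :
    ((wt U y x₀ k : ℝ) : ℂ) = fourierWeight 0 U (proj y) x₀ k :=
  Complex.conj_eq_iff_re.mp (conj_fourierWeight_zero_proj U y x₀ k)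

/-- The number of frames is `F = (4ⁿ)^{d+1}`. [cite: AharonovEtAl2023, Definition 3] -/
theorem card_frame_eq (d : ℕ) :
    (Fintype.card (Fin (d + 1) → ι → Pauli) : ℝ) = frameCount ι d := by
  simp only [Fintype.card_fun, Fintype.card_fin, Pauli.card_univ, frameCount]
  push_cast
  ring

omit [DecidableEq ι] in
/-- `F > 0`. [cite: AharonovEtAl2023, Definition 3] -/
theorem frameCount_pos (ι : Type*) [Fintype ι] (d : ℕ) : 0 < frameCount ι d := by
  unfold frameCount
  positivity

/-- Unfolding of the frame score: `XEB_γ(W) = 2ⁿ Σ_x p_W(x) p̃_W(x) − 1`.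
[cite: AharonovEtAl2023, §5 (display defining the linear cross entropy)] -/
theorem frameXEB_eq (γ : ℝ) {d : ℕ} (U : Fin d → Matrix (ι → Bool) (ι → Bool) ℂ) (y : ι → Bool)
    (W : Fin (d + 1) → ι → Pauli) :
    frameXEB γ U y W =
      (2 : ℝ) ^ Fintype.card ι * ∑ x, idealOut U y W x * noisyOut γ U y W x - 1 := by
  simp only [frameXEB, linearXEB, Fintype.card_fun, Fintype.card_bool]
  push_cast
  ring

/-- The frame-summed score: `Σ_W XEB_γ(W) = 2ⁿ Σ_W Σ_x p_W(x) p̃_W(x) − F`.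
[cite: AharonovEtAl2023, §5 (display before Theorem 4, first line)] -/
theorem sum_frameXEB_eq (γ : ℝ) {d : ℕ} (U : Fin d → Matrix (ι → Bool) (ι → Bool) ℂ) (y : ι → Bool) :
    ∑ W : Fin (d + 1) → ι → Pauli, frameXEB γ U y W =
      (2 : ℝ) ^ Fintype.card ι * ∑ W : Fin (d + 1) → ι → Pauli, ∑ x,
        idealOut U y W x * noisyOut γ U y W x - frameCount ι d := by
  rw [← card_frame_eq (ι := ι) d]
  simp only [frameXEB_eq, Finset.sum_sub_distrib, Finset.mul_sum, Finset.sum_const, Finset.card_univ,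
    nsmul_eq_mul, mul_one]

/-! ### (i) XEB is the weight enumerator -/

/-- **`E_W[XEB_γ] + 1 = Φ_C(1 − γ)`** — "the XEB of noisy random circuits can be viewed as the Fourier
weight polynomial": the frame-averaged honest noisy XEB score plus one is the weight enumerator at
`λ = 1 − γ` (any layer matrices, any basis input `y`, any reference output `x₀`, any real `γ`).
Real form of `sum_frame_sum_noisyValue_zero_mul_noisyValue`.
[cite: AharonovEtAl2023, §5 (display before Theorem 4: XEB = Σ_{k>0} (1−γ)^k W_k), arXiv p. 16] -/
theorem avgXEB_add_one_eq_weightEnumerator (γ : ℝ) {d : ℕ}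
    (U : Fin d → Matrix (ι → Bool) (ι → Bool) ℂ) (y x₀ : ι → Bool) :
    avgXEB γ U y + 1 = weightEnumerator (1 - γ) U y x₀ := by
  have hF := frameCount_pos ι d
  have hC := sum_frame_sum_noisyValue_zero_mul_noisyValue (γ : ℂ) U (proj y) x₀
  have hL : (((2 : ℝ) ^ Fintype.card ι * ∑ W : Fin (d + 1) → ι → Pauli, ∑ x : ι → Bool,
      idealOut U y W x * noisyOut γ U y W x : ℝ) : ℂ) =
      (2 : ℂ) ^ Fintype.card ι * ∑ W : Fin (d + 1) → ι → Pauli, ∑ x : ι → Bool,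
        noisyValue 0 (frameLayers U W) (proj y) (frameObs (proj x) W) *
          noisyValue (γ : ℂ) (frameLayers U W) (proj y) (frameObs (proj x) W) := by
    push_cast
    simp_rw [ofReal_idealOut, ofReal_noisyOut]
  have hR : ((frameCount ι d * weightEnumerator (1 - γ) U y x₀ : ℝ) : ℂ) =
      ((4 : ℂ) ^ Fintype.card ι) ^ (d + 1) *
        ∑ k ∈ Finset.range (Fintype.card ι * (d + 1) + 1),
          (1 - (γ : ℂ)) ^ k * fourierWeight 0 U (proj y) x₀ k := by
    unfold frameCount weightEnumerator
    push_cast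
    simp_rw [ofReal_wt]
  have hreal : (2 : ℝ) ^ Fintype.card ι * ∑ W : Fin (d + 1) → ι → Pauli, ∑ x : ι → Bool,
      idealOut U y W x * noisyOut γ U y W x = frameCount ι d * weightEnumerator (1 - γ) U y x₀ := by
    exact_mod_cast hL.trans (hC.trans hR.symm)
  rw [avgXEB, sum_frameXEB_eq, hreal]
  field_simp
  ring

/-! ### Lemma 4 items 1–2 in real form: `W_0 = 1`, `W_k = 0` for `0 < k ≤ d`, `W_k ≥ 0` -/

omit [Fintype ι] [DecidableEq ι] in
/-- A path has Hamming weight `0` iff it is the all-identity path.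
[cite: AharonovEtAl2023, Lemma 4 (item 1: "the unique all-identity path")] -/
theorem pathWeight_eq_zero_iff [Fintype ι] {d : ℕ} {s : Fin (d + 1) → ι → Pauli} :
    pathWeight s = 0 ↔ s = fun _ _ => Pauli.I := by
  rw [pathWeight_eq, Finset.sum_eq_zero_iff]
  constructor
  · intro h
    funext t
    exact strWeight_eq_zero_iff.1 (h t (Finset.mem_univ t))
  · rintro rfl t _
    exact strWeight_const_I

/-- **`W_k ≥ 0`** (a sum of squares of real coefficients). [cite: AharonovEtAl2023, Definition 5] -/
theorem wt_nonneg {d : ℕ} (U : Fin d → Matrix (ι → Bool) (ι → Bool) ℂ) (y x₀ : ι → Bool) (k : ℕ) :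
    0 ≤ wt U y x₀ k := by
  have h : fourierWeight 0 U (proj y) x₀ k =
      ((((2 : ℝ) ^ Fintype.card ι) ^ 2 *
        ∑ s ∈ Finset.univ.filter (fun s : Fin (d + 1) → ι → Pauli => pathWeight s = k),
          ‖pathCoeff 0 U (proj y) (proj x₀) s‖ ^ 2 : ℝ) : ℂ) := by
    rw [fourierWeight]
    push_cast
    congr 1
    exact Finset.sum_congr rfl fun s _ => by
      rw [sq_eq_ofReal_norm_sq' (conj_pathCoeff_zero U (conjTranspose_proj y) (conjTranspose_proj x₀) s),
        Complex.ofReal_pow]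
  rw [wt, h, Complex.ofReal_re]
  positivity

/-- **`W_0 = 1`** for unitary layers and a basis input (the all-identity path alone has weight `0`
and contributes `2^{-n}`). [cite: AharonovEtAl2023, Lemma 4 (item 1)] -/
theorem wt_zero {d : ℕ} {U : Fin d → Matrix (ι → Bool) (ι → Bool) ℂ}
    (hU : ∀ t, U t ∈ Matrix.unitaryGroup (ι → Bool) ℂ) (y x₀ : ι → Bool) : wt U y x₀ 0 = 1 := by
  have h : fourierWeight 0 U (proj y) x₀ 0 = 1 := by
    have hfil : Finset.univ.filter (fun s : Fin (d + 1) → ι → Pauli => pathWeight s = 0) =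
        {fun _ _ => Pauli.I} := by
      ext s
      simp [pathWeight_eq_zero_iff]
    rw [fourierWeight, hfil, Finset.sum_singleton]
    exact fourierWeight_zero 0 hU x₀ y
  simp [wt, h]

/-- **`W_k = 0` for `0 < k ≤ d`** for unitary layers (a contributing path is the all-identity path or
has weight `≥ d + 1`). [cite: AharonovEtAl2023, Lemma 4 (item 2)] -/
theorem wt_eq_zero_of_le {d : ℕ} {U : Fin d → Matrix (ι → Bool) (ι → Bool) ℂ}
    (hU : ∀ t, U t ∈ Matrix.unitaryGroup (ι → Bool) ℂ) (y x₀ : ι → Bool) {k : ℕ} (hk0 : k ≠ 0)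
    (hkd : k ≤ d) : wt U y x₀ k = 0 := by
  have h : fourierWeight 0 U (proj y) x₀ k = 0 := by
    rw [fourierWeight]
    refine mul_eq_zero_of_right _ (Finset.sum_eq_zero fun s hs => ?_)
    have hw : pathWeight s = k := (Finset.mem_filter.1 hs).2
    have hc : pathCoeff 0 U (proj y) (proj x₀) s = 0 := by
      by_contra hne
      rcases pathWeight_eq_zero_or_lt_of_pathCoeff_ne_zero 0 hU (proj y) (proj x₀) hne with h0 | hlt
      · exact hk0 (hw ▸ h0)
      · omega
    rw [hc, zero_pow two_ne_zero]
  simp [wt, h]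

/-- The XEB score as the enumerator WITHOUT its constant term:
`E_W XEB_γ = Σ_{1 ≤ k ≤ n(d+1)} (1−γ)^k W_k` (unitary layers: `W_0 = 1`).
[cite: AharonovEtAl2023, §5 (display before Theorem 4, last line: Σ_{k>0} (1−γ)^k W_k)] -/
theorem avgXEB_eq_sum_erase (γ : ℝ) {d : ℕ} {U : Fin d → Matrix (ι → Bool) (ι → Bool) ℂ}
    (hU : ∀ t, U t ∈ Matrix.unitaryGroup (ι → Bool) ℂ) (y x₀ : ι → Bool) :
    avgXEB γ U y =
      ∑ k ∈ (Finset.range (Fintype.card ι * (d + 1) + 1)).erase 0, (1 - γ) ^ k * wt U y x₀ k := by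
  have h := avgXEB_add_one_eq_weightEnumerator γ U y x₀
  have h0 : 0 ∈ Finset.range (Fintype.card ι * (d + 1) + 1) := Finset.mem_range.2 (Nat.succ_pos _)
  rw [weightEnumerator, ← Finset.add_sum_erase _ _ h0, pow_zero, one_mul, wt_zero hU y x₀] at h
  linarith

/-- `α′ = E_W XEB_0 ≥ 0` for unitary layers (it is `Σ_{k ≥ 1} W_k`).
[cite: AharonovEtAl2023, Definition 4 and Lemma 4] -/
theorem avgXEB_zero_nonneg {d : ℕ} {U : Fin d → Matrix (ι → Bool) (ι → Bool) ℂ}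
    (hU : ∀ t, U t ∈ Matrix.unitaryGroup (ι → Bool) ℂ) (y : ι → Bool) : 0 ≤ avgXEB 0 U y := by
  rw [avgXEB_eq_sum_erase 0 hU y y]
  exact Finset.sum_nonneg fun k _ => by
    rw [sub_zero, one_pow, one_mul]
    exact wt_nonneg U y y k

/-! ### (ii) The explicit two-sided noise sandwich -/

/-- **Ceiling** `E_W XEB_γ ≤ (1−γ)^{d+1} · E_W XEB_0` (unitary layers, `0 ≤ γ ≤ 1`): every contributing
non-identity path has weight `≥ d + 1` — the step `Σ_{k ≥ d+1} (1−γ)^k W_k ≤ O(1)·(1−γ)^{d+1}` of the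
proof of Theorem 4 with `O(1)` replaced by the exact total weight `α′ = Σ_{k≥1} W_k`.
[cite: AharonovEtAl2023, Theorem 4 (proof, upper bound)] -/
theorem avgXEB_le_pow_mul {d : ℕ} {U : Fin d → Matrix (ι → Bool) (ι → Bool) ℂ}
    (hU : ∀ t, U t ∈ Matrix.unitaryGroup (ι → Bool) ℂ) (y : ι → Bool) {γ : ℝ} (h0 : 0 ≤ γ)
    (h1 : γ ≤ 1) : avgXEB γ U y ≤ (1 - γ) ^ (d + 1) * avgXEB 0 U y := by
  rw [avgXEB_eq_sum_erase γ hU y y, avgXEB_eq_sum_erase 0 hU y y, Finset.mul_sum]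
  refine Finset.sum_le_sum fun k hk => ?_
  have hk0 : k ≠ 0 := (Finset.mem_erase.1 hk).1
  rw [sub_zero, one_pow, one_mul]
  by_cases hkd : k ≤ d
  · rw [wt_eq_zero_of_le hU y y hk0 hkd, mul_zero, mul_zero]
  · exact mul_le_mul_of_nonneg_right
      (pow_le_pow_of_le_one (by linarith) (by linarith) (by omega)) (wt_nonneg U y y k)

/-- **Floor** `(1−γ)^{n(d+1)} · E_W XEB_0 ≤ E_W XEB_γ` (unitary layers, `0 ≤ γ ≤ 1`): every path has
weight at most the number `n(d+1)` of noise locations ("the lower bound does not require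
anti-concentration"). [cite: AharonovEtAl2023, Theorem 4 (lower bound) and §3.2 (n(d+1) locations)] -/
theorem pow_mul_avgXEB_zero_le {d : ℕ} {U : Fin d → Matrix (ι → Bool) (ι → Bool) ℂ}
    (hU : ∀ t, U t ∈ Matrix.unitaryGroup (ι → Bool) ℂ) (y : ι → Bool) {γ : ℝ} (h0 : 0 ≤ γ)
    (h1 : γ ≤ 1) : (1 - γ) ^ (Fintype.card ι * (d + 1)) * avgXEB 0 U y ≤ avgXEB γ U y := by
  rw [avgXEB_eq_sum_erase γ hU y y, avgXEB_eq_sum_erase 0 hU y y, Finset.mul_sum]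
  refine Finset.sum_le_sum fun k hk => ?_
  have hkN : k ≤ Fintype.card ι * (d + 1) :=
    Nat.lt_succ_iff.1 (Finset.mem_range.1 (Finset.mem_erase.1 hk).2)
  rw [sub_zero, one_pow, one_mul]
  exact mul_le_mul_of_nonneg_right
    (pow_le_pow_of_le_one (by linarith) (by linarith) hkN) (wt_nonneg U y y k)

/-- **(ii) NOISE SANDWICH** `(1−γ)^{n(d+1)} · α′ ≤ E_W XEB_γ ≤ (1−γ)^{d+1} · α′` with `α′ = E_W XEB_0`,
for unitary layers and `0 ≤ γ ≤ 1`. [cite: AharonovEtAl2023, Theorem 4 (proof) and Lemma 4 (items 1–2)] -/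
theorem noisyXEBSandwich {d : ℕ} (U : Fin d → Matrix (ι → Bool) (ι → Bool) ℂ)
    (hU : ∀ t, U t ∈ Matrix.unitaryGroup (ι → Bool) ℂ) (y : ι → Bool) (γ : ℝ) (h0 : 0 ≤ γ)
    (h1 : γ ≤ 1) :
    (1 - γ) ^ (Fintype.card ι * (d + 1)) * avgXEB 0 U y ≤ avgXEB γ U y ∧
      avgXEB γ U y ≤ (1 - γ) ^ (d + 1) * avgXEB 0 U y :=
  ⟨pow_mul_avgXEB_zero_le hU y h0 h1, avgXEB_le_pow_mul hU y h0 h1⟩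

/-! ### The certificate's anti-concentration factor is `F · (α′ + 1)` exactly -/

/-- **Lemma 4's chain, real form**: `2ⁿ Σ_W Σ_x p_W(x)² = F · (E_W XEB_0 + 1) = F · Φ_C(1)` — the
anti-concentration factor of the truncation certificate is the frame count times one plus the ideal
mean XEB score of the same ensemble. [cite: AharonovEtAl2023, Lemma 4 (proof: E_C 2ⁿΣ_x p(C,x)² = Σ_k W_k)] -/
theorem two_pow_mul_sum_frame_sum_norm_sq_eq {d : ℕ} (U : Fin d → Matrix (ι → Bool) (ι → Bool) ℂ)
    (y : ι → Bool) :
    (2 : ℝ) ^ Fintype.card ι * ∑ W : Fin (d + 1) → ι → Pauli, ∑ x : ι → Bool,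
        ‖noisyValue 0 (frameLayers U W) (proj y) (frameObs (proj x) W)‖ ^ 2 =
      frameCount ι d * (avgXEB 0 U y + 1) := by
  rw [avgXEB_add_one_eq_weightEnumerator 0 U y y, sub_zero]
  have hC := sum_frame_sum_sq_noisyValue_proj 0 U (proj y) y
  have hsq : ∀ (W : Fin (d + 1) → ι → Pauli) (x : ι → Bool),
      noisyValue 0 (frameLayers U W) (proj y) (frameObs (proj x) W) ^ 2 =
        ((‖noisyValue 0 (frameLayers U W) (proj y) (frameObs (proj x) W)‖ ^ 2 : ℝ) : ℂ) := by
    intro W x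
    have h := conj_noisyValue_frame_proj 0 U y W x
    rw [Complex.ofReal_zero] at h
    exact sq_eq_ofReal_norm_sq' h
  simp_rw [hsq] at hC
  have hR : ((frameCount ι d * weightEnumerator 1 U y y : ℝ) : ℂ) =
      ((4 : ℂ) ^ Fintype.card ι) ^ (d + 1) *
        ∑ k ∈ Finset.range (Fintype.card ι * (d + 1) + 1), fourierWeight 0 U (proj y) y k := by
    unfold frameCount weightEnumerator
    push_cast
    simp_rw [one_pow, one_mul, ofReal_wt]
  exact_mod_cast hC.trans hR.symm

/-- **The certificate in closed form**: `AGLLVCertifies γ ε δ ℓ` reads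
`(1−γ)^{2(ℓ+1)} · (α′ + 1) ≤ δ ε²`. [cite: AharonovEtAl2023, §3.3 (Markov step) with Lemma 4] -/
theorem agllvCertifies_iff (γ ε δ : ℝ) (ℓ : ℕ) {d : ℕ} (U : Fin d → Matrix (ι → Bool) (ι → Bool) ℂ)
    (y : ι → Bool) :
    AGLLVCertifies γ ε δ ℓ U y ↔ ((1 - γ) ^ 2) ^ (ℓ + 1) * (avgXEB 0 U y + 1) ≤ δ * ε ^ 2 := by
  have hF := frameCount_pos ι d
  unfold AGLLVCertifies
  rw [mul_left_comm, two_pow_mul_sum_frame_sum_norm_sq_eq U y,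
    show ((1 - γ) ^ 2) ^ (ℓ + 1) * (frameCount ι d * (avgXEB 0 U y + 1)) =
      frameCount ι d * (((1 - γ) ^ 2) ^ (ℓ + 1) * (avgXEB 0 U y + 1)) by ring,
    show δ * frameCount ι d * ε ^ 2 = frameCount ι d * (δ * ε ^ 2) by ring]
  exact ⟨fun h => le_of_mul_le_mul_left h hF, fun h => mul_le_mul_of_nonneg_left h hF.le⟩

/-! ### (iii) The certificate-level dichotomy and (iii-S) the sufficient level -/

/-- **(iii) CERTIFICATE-LEVEL DICHOTOMY.** If the honest `γ`-noisy device passes the XEB test at level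
`χ > 0` on average AND the §3 certificate holds at level `ℓ` for `(ε, δ)`, then
`(α′ + 1)^{d+1} χ^{2(ℓ+1)} ≤ (δ ε²)^{d+1} α′^{2(ℓ+1)}`, i.e.
`ℓ + 1 ≥ (d+1) · ln((1+α′)/(δ ε²)) / (2 ln(α′/χ))` (unitary layers, `0 ≤ γ ≤ 1`): the XEB ceiling
`χ ≤ (1−γ)^{d+1} α′` against the certificate `(1−γ)^{2(ℓ+1)}(α′+1) ≤ δε²`. Elementary combination
recorded for the line `xeb-pauli-path-dichotomy`.
[cite: AharonovEtAl2023, Theorem 4 (proof, upper bound) and §3.3 (Markov step)] -/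
theorem certificateLevelDichotomy {d : ℕ} (U : Fin d → Matrix (ι → Bool) (ι → Bool) ℂ)
    (hU : ∀ t, U t ∈ Matrix.unitaryGroup (ι → Bool) ℂ) (y : ι → Bool) (γ : ℝ) (h0 : 0 ≤ γ)
    (h1 : γ ≤ 1) (χ ε δ : ℝ) (hχ : 0 < χ) (ℓ : ℕ) (hpass : χ ≤ avgXEB γ U y)
    (hcert : AGLLVCertifies γ ε δ ℓ U y) :
    (avgXEB 0 U y + 1) ^ (d + 1) * χ ^ (2 * (ℓ + 1)) ≤
      (δ * ε ^ 2) ^ (d + 1) * (avgXEB 0 U y) ^ (2 * (ℓ + 1)) := by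
  set α := avgXEB 0 U y with hα
  have hα0 : 0 ≤ α := avgXEB_zero_nonneg hU y
  have hl0 : 0 ≤ 1 - γ := by linarith
  have hceil : χ ≤ (1 - γ) ^ (d + 1) * α := hpass.trans (avgXEB_le_pow_mul hU y h0 h1)
  have hc : ((1 - γ) ^ 2) ^ (ℓ + 1) * (α + 1) ≤ δ * ε ^ 2 := (agllvCertifies_iff γ ε δ ℓ U y).1 hcert
  have hc0 : 0 ≤ ((1 - γ) ^ 2) ^ (ℓ + 1) * (α + 1) := mul_nonneg (by positivity) (by linarith)
  have hα1 : 0 ≤ α + 1 := by linarith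
  generalize 1 - γ = lam at hl0 hceil hc hc0
  have hpow : (lam ^ (d + 1)) ^ (2 * (ℓ + 1)) = ((lam ^ 2) ^ (ℓ + 1)) ^ (d + 1) := by
    rw [← pow_mul, ← pow_mul, ← pow_mul, Nat.mul_comm, Nat.mul_assoc]
  calc (α + 1) ^ (d + 1) * χ ^ (2 * (ℓ + 1))
      ≤ (α + 1) ^ (d + 1) * (lam ^ (d + 1) * α) ^ (2 * (ℓ + 1)) :=
        mul_le_mul_of_nonneg_left (pow_le_pow_left₀ hχ.le hceil _) (pow_nonneg hα1 _)
    _ = ((lam ^ 2) ^ (ℓ + 1) * (α + 1)) ^ (d + 1) * α ^ (2 * (ℓ + 1)) := by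
        rw [mul_pow, mul_pow, hpow]
        ring
    _ ≤ (δ * ε ^ 2) ^ (d + 1) * α ^ (2 * (ℓ + 1)) :=
        mul_le_mul_of_nonneg_right (pow_le_pow_left₀ hc0 hc _) (pow_nonneg hα0 _)

/-- **(iii-S) SUFFICIENT LEVEL.** The certificate HOLDS at every level with
`2γ(ℓ+1) ≥ ln((1+α′)/(δε²))` — the printed `ℓ ≥ (1/γ)·log(O(1)/(ε√δ))` with the `O(1)` made exact
(`= 1 + α′`, one plus the ideal mean XEB score of the same ensemble); unitary layers, `γ ≤ 1`,
`ε, δ > 0`. [cite: AharonovEtAl2023, §3.3 (display: ℓ ≥ γ⁻¹ log(O(1)/(ε√δ)), arXiv p. 13) and §3.1 (eq. (sumoflow))] -/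
theorem agllvSufficientLevel {d : ℕ} (U : Fin d → Matrix (ι → Bool) (ι → Bool) ℂ)
    (hU : ∀ t, U t ∈ Matrix.unitaryGroup (ι → Bool) ℂ) (y : ι → Bool) (γ : ℝ) (h1 : γ ≤ 1)
    (ε δ : ℝ) (hε : 0 < ε) (hδ : 0 < δ) (ℓ : ℕ)
    (hlog : Real.log ((avgXEB 0 U y + 1) / (δ * ε ^ 2)) ≤ 2 * γ * (ℓ + 1)) :
    AGLLVCertifies γ ε δ ℓ U y := by
  rw [agllvCertifies_iff]
  set α := avgXEB 0 U y with hα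
  have hα1 : 0 < α + 1 := by linarith [avgXEB_zero_nonneg hU y]
  have hq : 0 < (α + 1) / (δ * ε ^ 2) := by positivity
  have hpow : ((1 - γ) ^ 2) ^ (ℓ + 1) ≤ Real.exp (-(2 * γ * (ℓ + 1))) := by
    have h := one_sub_sq_pow_le_exp h1 (ℓ + 1)
    push_cast at h
    exact h
  have hexp : Real.exp (-(2 * γ * (ℓ + 1))) ≤ δ * ε ^ 2 / (α + 1) := by
    have h : Real.exp (-(2 * γ * (ℓ + 1))) ≤ Real.exp (-Real.log ((α + 1) / (δ * ε ^ 2))) :=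
      Real.exp_le_exp.2 (by linarith)
    have h' : Real.exp (-Real.log ((α + 1) / (δ * ε ^ 2))) = δ * ε ^ 2 / (α + 1) := by
      rw [Real.exp_neg, Real.exp_log hq, inv_div]
    exact h.trans h'.le
  calc ((1 - γ) ^ 2) ^ (ℓ + 1) * (α + 1) ≤ δ * ε ^ 2 / (α + 1) * (α + 1) :=
        mul_le_mul_of_nonneg_right (hpow.trans hexp) hα1.le
    _ = δ * ε ^ 2 := div_mul_cancel₀ _ hα1.ne'

end PauliPath

end Literature.Computability.QuantumComplexity
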